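/-
Copyright (c) 2026 the pub-hodgecm-mathlib formalisation cell (harness21).  Prover seat hodgecm-mathlib-K2E3-p25 (g3) (L4 architect), HCML Track B «K2-LIT» ∕ h413
(`stmt-HodgeConjecture-24833`).  NR-1′ «LeThree SWEEP» (director s1979∕s1980), twin 1∕≈20: ★ «CHAR-FIELD★» `F0P3cStCharTSCharField` (LH6-p01) re-read under the
NARROWED letter hHC₃ `characterLocallyIntegrableLeThree` (`2 ≤ N ≤ 3`, `v` non-split).  2026-09-04.
-/
import Summits.HodgeConjecture.HodgeConjecture.Theorems.F0P3cStCharTSCharField      -- ★ «CHAR-FIELD★» (LH6-p01): §0 generic modification lemmas, `charRegularity_of_forall`, `qsForm` facts — REUSED by name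
import Summits.HodgeConjecture.HodgeConjecture.Theorems.K2E3CharLettersLeThreeDefs   -- NR-1′ root: `characterLocallyIntegrableLeThree` (hHC₃)
import Literature.NumberTheory.Automorphic.UnitaryGroupNonsplitPlace                -- ★ `PlacesOver.eq_of_smul_eq` (one fixed place ⇒ every place over `v` is it)
import HarnessLib

/-!
# NR-1′ twin 1 — «CHAR-FIELD★» under hHC₃: the Harish-Chandra character field of `U(H)(L⁺_v)` for `2 ≤ N ≤ 3`, `v` non-split

Cell `pub/hodgecm-mathlib`, crux H413 = `stmt-HodgeConjecture-24833`, line L4; THEOREMS ONLY; count-neutral helper (`--supports … --as helper`).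
The four theorems of ★ `F0P3cStCharTSCharField` §1∕§2 that bind `(hHC : Ch1.characterLocallyIntegrable)` re-proved under the SAME NAMES in this namespace
(so every downstream twin is a namespace substitution) with the binder type replaced by hHC₃
= ★ `K2E3CharLettersLeThreeDefs.characterLocallyIntegrableLeThree` and the two extra arguments the narrowed letter asks for (`2 ≤ N`, `N ≤ 3`, and the non-split
hypothesis `∀ w ∣ v, conj • w = w`, derived from one fixed place by ★ `PlacesOver.eq_of_smul_eq` where the original took `(w) (hw)`).  Application site A1 of the architect's
cone memo; consumers: the twins of ★ `HFields`∕`HFieldsHcb` and ★ RUNG0₂₂ (:280).  The original ★ decls are untouched.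

HONEST LABEL: HC_CM is proved only modulo the 7 printed citations (2 remaining named inputs: hLiu418 = `stmt-HodgeConjecture-24832`, h413 = `stmt-HodgeConjecture-24833`)
until rung 0 closes; count-neutral; CONDITIONAL on the binder hHC₃ (the narrowed letter, stated not assumed).

## References
* [Rogawski1990] J. D. Rogawski, *Automorphic Representations of Unitary Groups in Three Variables* (1990), §1.6 p. 5; §12.5 p. 182.
* [HarishChandra1999] Harish-Chandra, *Admissible Invariant Distributions on Reductive p-adic Groups*, ULS 16 (1999), Thm. 16.3.
-/

set_option autoImplicit false
-- the mandated namespace has the single-problem summit's repeated segment (`HodgeConjecture.HodgeConjecture`)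
set_option linter.dupNamespace false

noncomputable section

open NumberField IsDedekindDomain MeasureTheory Filter Topology Set
open scoped Matrix MatrixGroups
open Literature.NumberTheory.Rogawski1990 Literature.NumberTheory.Automorphic Literature.NumberTheory.Automorphic.UnitaryGroup
open Summit.HodgeConjecture.HodgeConjecture.Cruxes.H413.K2E3CharLettersLeThreeDefs

namespace Summit.HodgeConjecture.HodgeConjecture.Cruxes.H413.K2E3CharFieldLeThree

/-! ## §0 «`v` non-split» from one fixed place -/

section Nonsplit

variable (L : Type) [Field L] [NumberField L] [IsCMField L] (v : HeightOneSpectrum (𝓞 ↥(maximalRealSubfield L)))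

/-- If ONE place `w ∣ v` is fixed by complex conjugation then EVERY place over `v` is (it is the only one, ★ `PlacesOver.eq_of_smul_eq`) — the organ's spelling of
«`v` non-split» from the `(w) (hw)` spelling of the Track-A consumers. [cite: Rogawski1990, §1.9 p. 8] -/
theorem forall_smul_placesOver_eq_of_smul_eq (w : PlacesOver L v) (hw : IsCMField.complexConj L • w.1 = w.1) :
    ∀ w' : PlacesOver L v, IsCMField.complexConj L • w'.1 = w'.1 := fun w' => by
  rw [PlacesOver.eq_of_smul_eq (IsCMField.complexConj L) (IsCMField.complexConj_ne_one L) w hw w']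
  exact hw

end Nonsplit

/-! ## §1 The Harish-Chandra character of every class of `U(H)(L⁺_v)` (`2 ≤ N ≤ 3`, `v` non-split) with the four (M1) clauses, from hHC₃ -/

section Local

variable (L : Type) [Field L] [NumberField L] [IsCMField L] {N : ℕ} (H : Matrix (Fin N) (Fin N) L)
  (v : HeightOneSpectrum (𝓞 ↥(maximalRealSubfield L)))

/-- **(M1) for every class, from hHC₃ — core form** (★ `exists_charRegular_of_characterLocallyIntegrable` with the narrowed letter: extra hypotheses `2 ≤ N`, `N ≤ 3`,
`∀ w ∣ v, conj • w = w`; same proof). [cite: Rogawski1990, §1.6 p. 5] [cite: HarishChandra1999, Thm. 16.3] -/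
theorem exists_charRegular_of_characterLocallyIntegrable (hHC : characterLocallyIntegrableLeThree) (hN2 : 2 ≤ N) (hN3 : N ≤ 3)
    (hH : (H.map (cmConjRingHom L))ᵀ = H) (hdet : H.det ≠ 0)
    (hns : ∀ w : PlacesOver L v, IsCMField.complexConj L • w.1 = w.1)
    [MeasurableSpace ((cmDatum L N H).Local v)] [BorelSpace ((cmDatum L N H).Local v)]
    (hR : IsOpen {γ : (cmDatum L N H).Local v | IsRegularElt (γ.val : GL (Fin N) (LocalRing L v))})
    (μ : Measure ((cmDatum L N H).Local v)) [μ.IsHaarMeasure] (c : IrrClass ((cmDatum L N H).Local v)) :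
    ∃ Θ : (cmDatum L N H).Local v → ℂ, Measurable Θ ∧ LocallyIntegrable Θ μ ∧
      (∀ x : (cmDatum L N H).Local v, IsRegularElt (x.val : GL (Fin N) (LocalRing L v)) → ∀ᶠ y in 𝓝 x, Θ y = Θ x) ∧
      ∀ φ : (cmDatum L N H).Local v → ℂ, IsLocSmooth φ → c.smoothTrace μ φ = ∫ x, φ x * Θ x ∂μ := by
  obtain ⟨Θ, hli, hlc, htr⟩ := hHC L N hN2 hN3 H hH hdet v hns μ c
  obtain ⟨Θ', hmeas, hae, -, hev⟩ :=
    F0P3cStCharTSCharField.exists_measurable_modification_of_isLocallyConstant_on (μ := μ) hR hli.aestronglyMeasurable.aemeasurable hlc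
  refine ⟨Θ', hmeas, F0P3cStCharTSCharField.locallyIntegrable_congr_ae hli hae, fun x hx => hev x hx, fun φ hφ => ?_⟩
  rw [htr φ ((F0P3cStCharTSCharField.isLocSmooth_iff_mem_schwartzBruhat φ).1 hφ)]
  exact integral_congr_ae (by filter_upwards [hae] with x hx; rw [hx])

/-- **(M1) for every class at a NON-SPLIT place** (`w ∣ v` fixed by conjugation; the regular locus is open there, ★ `isOpen_setOf_isRegularElt_cmDatum_local`), from hHC₃.
[cite: Rogawski1990, §1.6 p. 5] [cite: HarishChandra1999, Thm. 16.3] -/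
theorem exists_charRegular_of_characterLocallyIntegrable_of_nonsplit (hHC : characterLocallyIntegrableLeThree) (hN2 : 2 ≤ N) (hN3 : N ≤ 3)
    (hH : (H.map (cmConjRingHom L))ᵀ = H) (hdet : H.det ≠ 0)
    (w : PlacesOver L v) (hw : IsCMField.complexConj L • w.1 = w.1)
    [MeasurableSpace ((cmDatum L N H).Local v)] [BorelSpace ((cmDatum L N H).Local v)]
    (μ : Measure ((cmDatum L N H).Local v)) [μ.IsHaarMeasure] (c : IrrClass ((cmDatum L N H).Local v)) :
    ∃ Θ : (cmDatum L N H).Local v → ℂ, Measurable Θ ∧ LocallyIntegrable Θ μ ∧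
      (∀ x : (cmDatum L N H).Local v, IsRegularElt (x.val : GL (Fin N) (LocalRing L v)) → ∀ᶠ y in 𝓝 x, Θ y = Θ x) ∧
      ∀ φ : (cmDatum L N H).Local v → ℂ, IsLocSmooth φ → c.smoothTrace μ φ = ∫ x, φ x * Θ x ∂μ :=
  exists_charRegular_of_characterLocallyIntegrable L H v hHC hN2 hN3 hH hdet (forall_smul_placesOver_eq_of_smul_eq L v w hw)
    (isOpen_setOf_isRegularElt_cmDatum_local L H w hw) μ c

/-- **The character FAMILY** `χ : IrrClass G → G → ℂ` with the (M1) clauses at every class, from hHC₃ (choice over `exists_charRegular_of_characterLocallyIntegrable`).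
[cite: Rogawski1990, §1.6 p. 5; §12.5 p. 182] -/
theorem exists_charFamily_of_characterLocallyIntegrable (hHC : characterLocallyIntegrableLeThree) (hN2 : 2 ≤ N) (hN3 : N ≤ 3)
    (hH : (H.map (cmConjRingHom L))ᵀ = H) (hdet : H.det ≠ 0)
    (hns : ∀ w : PlacesOver L v, IsCMField.complexConj L • w.1 = w.1)
    [MeasurableSpace ((cmDatum L N H).Local v)] [BorelSpace ((cmDatum L N H).Local v)]
    (hR : IsOpen {γ : (cmDatum L N H).Local v | IsRegularElt (γ.val : GL (Fin N) (LocalRing L v))})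
    (μ : Measure ((cmDatum L N H).Local v)) [μ.IsHaarMeasure] :
    ∃ char : IrrClass ((cmDatum L N H).Local v) → (cmDatum L N H).Local v → ℂ,
      ∀ c : IrrClass ((cmDatum L N H).Local v), Measurable (char c) ∧ LocallyIntegrable (char c) μ ∧
        (∀ x : (cmDatum L N H).Local v, IsRegularElt (x.val : GL (Fin N) (LocalRing L v)) → ∀ᶠ y in 𝓝 x, char c y = char c x) ∧
        ∀ φ : (cmDatum L N H).Local v → ℂ, IsLocSmooth φ → c.smoothTrace μ φ = ∫ x, φ x * char c x ∂μ :=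
  ⟨fun c => (exists_charRegular_of_characterLocallyIntegrable L H v hHC hN2 hN3 hH hdet hns hR μ c).choose,
    fun c => (exists_charRegular_of_characterLocallyIntegrable L H v hHC hN2 hN3 hH hdet hns hR μ c).choose_spec⟩

end Local

/-! ## §2 The `U(Φ₃)(L⁺_v)` instance (N = 3), from hHC₃ -/

section U3

open Literature.NumberTheory.Rogawski1990.Ch12Sec5

variable (L : Type) [Field L] [NumberField L] [IsCMField L] (v : HeightOneSpectrum (𝓞 ↥(maximalRealSubfield L)))

/-- **(M1) ON `U(Φ₃)(L⁺_v)` AT A NON-SPLIT PLACE, from hHC₃** (★ `exists_charFamily_charRegularity_Gqs` re-read: `N = 3`, `w hw`; same proof with `(by norm_num) le_rfl` and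
the non-split hypothesis from `w hw`). [cite: Rogawski1990, §1.6 p. 5; §12.5 p. 182] [cite: HarishChandra1999, Thm. 16.3] -/
theorem exists_charFamily_charRegularity_Gqs (hHC : characterLocallyIntegrableLeThree)
    (w : PlacesOver L v) (hw : IsCMField.complexConj L • w.1 = w.1)
    [MeasurableSpace (Gqs L v)] [BorelSpace (Gqs L v)]
    [∀ γ : Gqs L v, MeasurableSpace (Gqs L v ⧸ Subgroup.centralizer ({γ} : Set (Gqs L v)))]
    [MeasurableSpace (Gqs L v ⧸ Subgroup.center (Gqs L v))]
    {H' : Type} [Group H'] [TopologicalSpace H'] [IsTopologicalGroup H'] [MeasurableSpace H']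
    (νQv : Measure (Gqs L v)) [νQv.IsHaarMeasure] :
    ∃ char : IrrClass (Gqs L v) → Gqs L v → ℂ,
      (∀ c : IrrClass (Gqs L v), Measurable (char c) ∧ LocallyIntegrable (char c) νQv ∧
        (∀ x : Gqs L v, IsRegularElt (x.val : GL (Fin 3) (LocalRing L v)) → ∀ᶠ y in 𝓝 x, char c y = char c x) ∧
        ∀ φ : Gqs L v → ℂ, IsLocSmooth φ → c.smoothTrace νQv φ = ∫ x, φ x * char c x ∂νQv) ∧
      ∀ 𝔇 : EllipticData (Gqs L v) H', 𝔇.char = char → 𝔇.μG = νQv →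
        (∀ γ : Gqs L v, γ ∈ 𝔇.regG ↔ IsRegularElt (γ.val : GL (Fin 3) (LocalRing L v))) → 𝔇.CharRegularity := by
  obtain ⟨char, hchar⟩ := exists_charFamily_of_characterLocallyIntegrable L (qsForm L) v hHC (by norm_num) le_rfl
    (F0P3cStCharTSCharField.qsForm_map_cmConjRingHom_transpose L) (F0P3cStCharTSCharField.det_qsForm_ne_zero L) (forall_smul_placesOver_eq_of_smul_eq L v w hw)
    (isOpen_setOf_isRegularElt_cmDatum_local L (qsForm L) w hw) νQv
  refine ⟨char, hchar, fun 𝔇 hc hμ hreg => F0P3cStCharTSCharField.charRegularity_of_forall 𝔇 fun π => ?_⟩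
  obtain ⟨h1, h2, h3, h4⟩ := hchar π
  rw [hc, hμ]
  exact ⟨h1, h2, fun x hx => h3 x ((hreg x).1 hx), h4⟩

end U3

end Summit.HodgeConjecture.HodgeConjecture.Cruxes.H413.K2E3CharFieldLeThree

end
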